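import Literature.Probability.LatticeModels.FKInterfacePairingProofs
import HarnessLib

/-!
# Lemma 4.5 at every interior medial vertex, and the dart fluxes near the boundary arcs

Topic `Literature/Probability/LatticeModels`; an instalment of the discharge programme for
crit-ising.S18 (`Sweep1Proofs.lean`: Smirnov's Theorem 2.2), nodes 2–3 of the DAG recorded there
(the discrete primitive `H = Im ∫ F²` and its boundary values). Everything here is proved.

## 1. Smirnov's Lemma 4.5 at *all* interior medial vertices (`…_free`)

Node 1 of the programme (`SHolomorphicityProof.lean`, assembled in `FKInterfacePairingProofs`)
proves the antipodal identities of Smirnov 2010, Lemma 4.5 — the two dart observables arriving at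
an edge `e = cTgt p`, and the two leaving it, each add up to `κ F(e)` (`dartObs_add_dartObs_partner`,
`dartObs_out`) — under the hypothesis that **all eight faces** at the two endpoints of `e` are inner
(`hx`, `hy`), which excludes the edges with an endpoint on the wired arc `A`. In Smirnov's medial
domain these edges (`e = {a, y}`, `a ∈ A`, `e` not an `A`–`A` edge, no endpoint on `B`) are
*interior* vertices — all four medial edges at them are available to the interface and the turn at
`e` is random — and the printed proof ("the only global information needed is that the graph is
planar", Remark 4.7) covers them. Inspection of the tree's proof shows that `hx`, `hy` are used only
(i) to know that the two faces of `e` (the faces of `p` and of its partner) are inner and (ii) to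
rule out that `p` is the exit corner, which already follows from `e` having no endpoint on `B`.
Part 1 re-runs the case-1 bookkeeping (`cornerOrbit_toggle_case1`, `arrivalSum_case1`,
`pair_weighted`, `sum_weighted_arrivalSum`) under the weaker hypotheses "both faces of `e` inner",
and concludes `dartObs_add_dartObs_partner_free`, `dartObs_out_free`: Lemma 4.5 at every edge of
the interface graph that is not an `A`–`A` edge and whose two faces are inner (for the remaining
free edges — no inner face at all — all four dart observables vanish).

## 2. The dart fluxes (Smirnov's `|F(e)|²`) and their closedness

`dartFlux D hD q = ‖dartObs D hD q‖²` is Smirnov's increment `H(B) - H(W) = |F(e)|²` of the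
discrete primitive across the medial edge `q` (Lemma 3.6, eq. (3.3)), for the FK observable with
all its normalisations (`κ = cos(π/8)` included). Consequences proved here:

* `dartFlux_closed_free` (**Lemma 3.6 at interior medial vertices**, via Lemma 4.5 and Lemma 4.1:
  the two arriving darts carry orthogonal lines, Pythagoras): at a free edge with both faces inner,
  flux(in₁) + flux(in₂) = `κ² ‖F(e)‖²` = flux(out₁) + flux(out₂);
* `dartObs_follow_of_forall_mem`, `dartObs_cross_of_forall_not_mem` (**Lemma 4.11, the RBVP at
  boundary vertices**): across an edge whose status is the same in every completed configuration
  (an `A`–`A` edge of `Ω_δ` is always open, an edge touching `B` always closed) the passages of the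
  interface through a dart and through its forced successor correspond bijectively with a
  deterministic relative quarter turn, so the two dart observables differ by the unit factor
  `quarterPhase (∓1)` and have equal fluxes (`dartFlux_follow_eq`, `dartFlux_cross_eq`);
* `cornerOrbit_fst_not_mem_zdArcB`, `dartObs_eq_zero_of_mem_zdArcB` (**`H` is locally constant
  along the free arc**): no dart of the interface has its vertex on the discrete arc `B` (edges
  touching `B` are closed, so such a dart could only be entered by turning around its own vertex),
  hence every dart at a `B`-site has zero flux: `H(f) = H(b)` for every inner face `f` at a site
  `b ∈ B`;
* `dartObs_startCorner`, `dartFlux_startCorner` (**the jump at `a`**): the start dart is passed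
  exactly once, first, with weight `1`, so its flux is `1` ("`H(v) = H(u) + |F(b)|² = 1`" in the
  proof of Lemma 4.11, at the tree's winding origin `e_a`).

The global primitive `H` on `Ω_δ` (single-valuedness needs the simple connectivity of the face
domain) and its sub/superharmonicity near the arcs are the next instalments.

## References

* S. Smirnov, *Conformal invariance in random cluster models. I*, Ann. of Math. 172 (2010)
  1435–1467: Lemma 3.6, Def. 3.4, Lemma 3.10, Lemma 4.1, Lemma 4.5 with Remarks 4.6–4.7,
  Lemma 4.11 — bib key `Smirnov2010`.
-/

noncomputable section

namespace Literature.Probability.LatticeModels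

open Finset SimpleGraph

/-! ## Part 1. Case 1 of the rearrangement under the weak hypotheses -/

section Cases

variable {D : DiscreteDobrushin} {ω ω' : Percolation.BondConfig (Site 2)} {c₀ p : Site 2 × Fin 4}

local notation "β" => D.bcBondConfig ω
local notation "β'" => D.bcBondConfig ω'
local notation "orb" => cornerOrbit (D.bcBondConfig ω) c₀
local notation "orb'" => cornerOrbit (D.bcBondConfig ω') c₀

/-- **Case 1 of the rearrangement, weak hypotheses** (`cornerOrbit_toggle_case1` with "all faces
at the endpoints inner" replaced by "the faces of `p` and of its partner are inner, and the far
endpoint of the toggled edge is off the arc `B`"). Let `p = orb i₁` (`i₁ < N`) be a dart of the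
exploration whose partner `p₂` is not, and `Q` the minimal period of the loop `L` of `p₂` under
the original turning rule. Then the toggled orbit runs along the original path up to `p`, once
around `L`, and finishes along the original path, exiting at time `N + Q` with all earlier faces
inner. [cite: Smirnov2010, proof of Lemma 4.5] -/
theorem cornerOrbit_toggle_case1_free (hD : D.IsZdAdmissible) (hc₀ : D.IsStartCorner c₀)
    (hagree : ∀ e, e ≠ cTgt p → (e ∈ β' ↔ e ∈ β)) (hdiff : ¬ (cTgt p ∈ β' ↔ cTgt p ∈ β))
    (hpf : D.IsInnerFace (cFace p)) (hp₂f : D.IsInnerFace (cFace (cornerPartner p)))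
    (hpB : p.1 + cornerUnit (p.2 + 1) ∉ D.zdArcB)
    {N P Q i₁ : ℕ} (hN : ¬ D.IsInnerFace (cFace (orb N))) (hlt : ∀ k < N, D.IsInnerFace (cFace (orb k)))
    (hP0 : 0 < P) (hP : orb P = c₀) (hPmin : ∀ s, 0 < s → s < P → orb s ≠ c₀)
    (hQ0 : 0 < Q) (hQ : cornerOrbit β (cornerPartner p) Q = cornerPartner p)
    (hQmin : ∀ s, 0 < s → s < Q → cornerOrbit β (cornerPartner p) s ≠ cornerPartner p)
    (hi₁ : orb i₁ = p) (hi₁N : i₁ < N) (h₂ : ∀ i < N, orb i ≠ cornerPartner p) :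
    (∀ i ≤ i₁, orb' i = orb i) ∧
    (∀ j, j + 1 ≤ Q → orb' (i₁ + 1 + j) = cornerOrbit β (cornerPartner p) (j + 1)) ∧
    (∀ j, i₁ + 1 + j ≤ N → orb' (i₁ + Q + 1 + j) = orb (i₁ + 1 + j)) ∧
    (∀ k < N + Q, D.IsInnerFace (cFace (orb' k))) ∧ ¬ D.IsInnerFace (cFace (orb' (N + Q))) := by
  set p₂ := cornerPartner p with hp₂
  have hp₂inner : D.IsInnerFace (cFace p₂) := hp₂f
  -- darts of the path are distinct
  have hinj : ∀ a b, a < N → b < N → orb a = orb b → a = b := by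
    intro a b ha hb h
    by_contra hne
    rcases Nat.lt_or_gt_of_ne hne with hab | hab
    · exact cornerOrbit_ne hD hc₀ hab (fun k hk => hlt k (by omega)) h
    · exact cornerOrbit_ne hD hc₀ hab (fun k hk => hlt k (by omega)) h.symm
  -- Step A: the loop through the partner never meets the interface cycle
  have hdisj : ∀ m s, cornerOrbit β p₂ m ≠ orb s := by
    intro m s h
    obtain ⟨s', hs'⟩ := exists_eq_cornerOrbit_of_iterate hP0 hP m h
    have hin : D.IsInnerFace (cFace (orb s')) := hs' ▸ hp₂inner
    rw [isInnerFace_cornerOrbit_iff hD hc₀ hN hlt hP0 hP hPmin] at hin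
    exact h₂ _ hin (by rw [cornerOrbit_mod_period hP]; exact hs'.symm)
  -- the prefix
  have hpre : ∀ i ≤ i₁, orb' i = orb i := by
    intro i hi
    induction i with
    | zero => rfl
    | succ i ih =>
      rw [cornerOrbit_succ, cornerOrbit_succ, ih (by omega)]
      refine nextCorner_toggle_of_ne hagree hdiff (fun h => ?_) (fun h => h₂ i (by omega) h)
      have := hinj i i₁ (by omega) hi₁N (h.trans hi₁.symm); omega
  -- Step B: around the loop
  have hloop : ∀ j, j + 1 ≤ Q → orb' (i₁ + 1 + j) = cornerOrbit β p₂ (j + 1) := by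
    intro j hj
    induction j with
    | zero =>
      rw [add_zero, cornerOrbit_succ, hpre i₁ le_rfl, hi₁, nextCorner_toggle hagree hdiff, Equiv.swap_apply_left]
      rfl
    | succ j ih =>
      rw [← add_assoc, cornerOrbit_succ, ih (by omega)]
      change nextCorner β' (cornerOrbit β p₂ (j + 1)) = nextCorner β (cornerOrbit β p₂ (j + 1))
      refine nextCorner_toggle_of_ne hagree hdiff (fun h => hdisj (j + 1) i₁ (h.trans hi₁.symm)) ?_
      exact hQmin (j + 1) (Nat.succ_pos _) (by omega)
  -- Step C: back on the path
  have hback : orb' (i₁ + Q + 1) = orb (i₁ + 1) := by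
    have h1 : orb' (i₁ + Q) = p₂ := by
      have := hloop (Q - 1) (by omega)
      rwa [show i₁ + 1 + (Q - 1) = i₁ + Q by omega, Nat.sub_add_cancel hQ0, hQ] at this
    rw [cornerOrbit_succ, h1, nextCorner_toggle hagree hdiff, hp₂, Equiv.swap_apply_right, cornerOrbit_succ, hi₁]
  have htail : ∀ j, i₁ + 1 + j ≤ N → orb' (i₁ + Q + 1 + j) = orb (i₁ + 1 + j) := by
    intro j hj
    induction j with
    | zero => rw [add_zero, add_zero, hback]
    | succ j ih =>
      rw [← add_assoc, cornerOrbit_succ, ih (by omega), ← add_assoc, cornerOrbit_succ]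
      refine nextCorner_toggle_of_ne hagree hdiff (fun h => ?_) (fun h => h₂ _ (by omega) h)
      have := hinj _ _ (by omega) hi₁N (h.trans hi₁.symm); omega
  -- Step D: the loop consists of inner corners
  have hloopin : ∀ j, j + 1 ≤ Q → D.IsInnerFace (cFace (cornerOrbit β p₂ (j + 1))) := by
    by_contra hcon
    push Not at hcon
    classical
    obtain ⟨hj₀Q, hj₀bad⟩ := Nat.find_spec hcon
    have hj₀min : ∀ j < Nat.find hcon, j + 1 ≤ Q → D.IsInnerFace (cFace (cornerOrbit β p₂ (j + 1))) := by
      intro j hj hjQ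
      by_contra hbad
      exact Nat.find_min hcon hj ⟨hjQ, hbad⟩
    -- the toggled orbit exits at time `i₁ + 1 + j₀`
    set M := i₁ + 1 + Nat.find hcon with hM
    have hout : ¬ D.IsInnerFace (cFace (orb' M)) := by rw [hM, hloop _ hj₀Q]; exact hj₀bad
    have hinM : D.IsInnerFace (cFace (orb' (M - 1))) := by
      rcases Nat.eq_zero_or_pos (Nat.find hcon) with h0 | hpos
      · rw [show M - 1 = i₁ by omega, hpre i₁ le_rfl, hi₁]; exact hpf
      · rw [show M - 1 = i₁ + 1 + (Nat.find hcon - 1) by omega, hloop _ (by omega)]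
        exact hj₀min _ (by omega) (by omega)
    have hexit' : D.IsExitCorner (orb' (M - 1)) :=
      isExitCorner_cornerOrbit hD hc₀ hinM (by rwa [show M - 1 + 1 = M by omega])
    obtain ⟨N₁, rfl⟩ : ∃ N₁, N = N₁ + 1 := ⟨N - 1, by omega⟩
    have hexit : D.IsExitCorner (orb N₁) := isExitCorner_cornerOrbit hD hc₀ (hlt N₁ (Nat.lt_succ_self _)) hN
    have heq := hexit'.eq hD hexit
    rcases Nat.eq_zero_or_pos (Nat.find hcon) with h0 | hpos
    · -- then `p` itself would be the exit corner, but its target edge does not touch `B`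
      rw [show M - 1 = i₁ by omega, hpre i₁ le_rfl, hi₁] at heq
      exact hpB (heq ▸ hexit).mem_zdArcB
    · rw [show M - 1 = i₁ + 1 + (Nat.find hcon - 1) by omega, hloop _ (by omega),
        show Nat.find hcon - 1 + 1 = Nat.find hcon by omega] at heq
      exact hdisj _ _ heq
  refine ⟨hpre, hloop, htail, fun k hk => ?_, ?_⟩
  · -- Step E: all faces before `N + Q` are inner
    by_cases hk1 : k ≤ i₁
    · rw [hpre k hk1]; exact hlt k (by omega)
    · by_cases hk2 : k ≤ i₁ + Q
      · rw [show k = i₁ + 1 + (k - i₁ - 1) by omega, hloop _ (by omega)]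
        exact hloopin _ (by omega)
      · rw [show k = i₁ + Q + 1 + (k - i₁ - Q - 1) by omega, htail _ (by omega)]
        exact hlt _ (by omega)
  · have := htail (N - i₁ - 1) (by omega)
    rw [show i₁ + Q + 1 + (N - i₁ - 1) = N + Q by omega, show i₁ + 1 + (N - i₁ - 1) = N by omega] at this
    rwa [this]

open scoped Classical in
/-- **The pair identity, case 1, weak hypotheses** (`arrivalSum_case1` with the faces of `p` and of
its partner inner and the far endpoint of `e = cTgt p` off the arc `B`, instead of all faces at the
endpoints inner). [cite: Smirnov2010, proof of Lemma 4.5] -/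
theorem arrivalSum_case1_free (hD : D.IsZdAdmissible) (hc₀ : D.IsStartCorner c₀)
    (hagree : ∀ e, e ≠ cTgt p → (e ∈ β' ↔ e ∈ β)) (hdiff : ¬ (cTgt p ∈ β' ↔ cTgt p ∈ β)) (he : cTgt p ∉ β)
    (hT2 : medialCycle_turning)
    (hpf : D.IsInnerFace (cFace p)) (hp₂f : D.IsInnerFace (cFace (cornerPartner p)))
    (hpB : p.1 + cornerUnit (p.2 + 1) ∉ D.zdArcB)
    {N P Q i₁ : ℕ} (hN : ¬ D.IsInnerFace (cFace (orb N))) (hlt : ∀ k < N, D.IsInnerFace (cFace (orb k)))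
    (hP0 : 0 < P) (hP : orb P = c₀) (hPmin : ∀ s, 0 < s → s < P → orb s ≠ c₀)
    (hQ0 : 0 < Q) (hQ : cornerOrbit β (cornerPartner p) Q = cornerPartner p)
    (hQmin : ∀ s, 0 < s → s < Q → cornerOrbit β (cornerPartner p) s ≠ cornerPartner p)
    (hi₁ : orb i₁ = p) (hi₁N : i₁ < N) (h₂ : ∀ i < N, orb i ≠ cornerPartner p) (φ : ℤ → ℂ)
    (hφ1 : ∀ a : ℂ, (Real.sqrt 2 : ℂ) * (a * φ 1) + (a * φ (-1) + a * eighthPhase 4 * φ (-1)) = 0) :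
    (Real.sqrt 2 : ℂ) * arrivalSum φ β c₀ p N + arrivalSum φ β' c₀ p (N + Q) = 0 := by
  classical
  set p₂ := cornerPartner p with hp₂
  have he' : cTgt p ∈ β' := by
    by_contra h; exact hdiff ⟨fun h' => absurd h' h, fun h' => absurd h' he⟩
  have hinj : ∀ a b, a < N → b < N → orb a = orb b → a = b := by
    intro a b ha hb h
    by_contra hne
    rcases Nat.lt_or_gt_of_ne hne with hab | hab
    · exact cornerOrbit_ne hD hc₀ hab (fun k hk => hlt k (by omega)) h
    · exact cornerOrbit_ne hD hc₀ hab (fun k hk => hlt k (by omega)) h.symm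
  -- the loop never meets the interface cycle
  have hdisj : ∀ m s, cornerOrbit β p₂ m ≠ orb s := by
    intro m s h
    obtain ⟨s', hs'⟩ := exists_eq_cornerOrbit_of_iterate hP0 hP m h
    have hin : D.IsInnerFace (cFace (orb s')) := hs' ▸ hp₂f
    rw [isInnerFace_cornerOrbit_iff hD hc₀ hN hlt hP0 hP hPmin] at hin
    exact h₂ _ hin (by rw [cornerOrbit_mod_period hP]; exact hs'.symm)
  obtain ⟨hpre, hloop, htail, -, -⟩ := cornerOrbit_toggle_case1_free hD hc₀ hagree hdiff hpf hp₂f hpB hN hlt hP0 hP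
    hPmin hQ0 hQ hQmin hi₁ hi₁N h₂
  -- the arrivals of `ω`: exactly `i₁`
  have hfilt : (Finset.range N).filter (fun j => orb j = p ∨ orb j = p₂) = {i₁} := by
    ext j
    simp only [Finset.mem_filter, Finset.mem_range, Finset.mem_singleton]
    constructor
    · rintro ⟨hj, h | h⟩
      · exact hinj j i₁ hj hi₁N (h.trans hi₁.symm)
      · exact absurd h (h₂ j hj)
    · rintro rfl; exact ⟨hi₁N, Or.inl hi₁⟩
  -- the arrivals of `ω ∪ e`: `i₁` and `i₁ + Q`
  have hloopQ : orb' (i₁ + Q) = p₂ := by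
    have := hloop (Q - 1) (by omega)
    rwa [show i₁ + 1 + (Q - 1) = i₁ + Q by omega, Nat.sub_add_cancel hQ0, hQ] at this
  have hfilt' : (Finset.range (N + Q)).filter (fun j => orb' j = p ∨ orb' j = p₂) = {i₁, i₁ + Q} := by
    ext j
    simp only [Finset.mem_filter, Finset.mem_range, Finset.mem_insert, Finset.mem_singleton]
    constructor
    · rintro ⟨hj, h⟩
      by_cases hj1 : j ≤ i₁
      · rw [hpre j hj1] at h
        rcases h with h | h
        · exact Or.inl (hinj j i₁ (by omega) hi₁N (h.trans hi₁.symm))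
        · exact absurd h (h₂ j (by omega))
      · by_cases hj2 : j ≤ i₁ + Q
        · right
          have hl := hloop (j - i₁ - 1) (by omega)
          rw [show i₁ + 1 + (j - i₁ - 1) = j by omega] at hl
          rw [hl] at h
          rcases h with h | h
          · exact absurd (h.trans hi₁.symm) (hdisj _ _)
          · by_contra hne
            exact hQmin (j - i₁ - 1 + 1) (Nat.succ_pos _) (by omega) h
        · exfalso
          have ht := htail (j - i₁ - Q - 1) (by omega)
          rw [show i₁ + Q + 1 + (j - i₁ - Q - 1) = j by omega] at ht
          rw [ht] at h
          have hidx : i₁ + 1 + (j - i₁ - Q - 1) < N := by omega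
          rcases h with h | h
          · have := hinj _ i₁ hidx hi₁N (h.trans hi₁.symm); omega
          · exact h₂ _ hidx h
    · rintro (rfl | rfl)
      · exact ⟨by omega, Or.inl (by rw [hpre j le_rfl, hi₁])⟩
      · exact ⟨by omega, Or.inr hloopQ⟩
  -- targets before `i₁` are not `e`; same prefix turn count
  have htgt : ∀ j < N, j ≠ i₁ → cTgt (orb j) ≠ cTgt p := by
    intro j hj h1 h
    rcases cTgt_eq_cTgt_iff.1 h with h | h
    · exact h1 (hinj j i₁ hj hi₁N (h.trans hi₁.symm))
    · exact h₂ j hj h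
  have hC : turnCount β' c₀ i₁ = turnCount β c₀ i₁ :=
    turnCount_congr_prefix hpre fun j hj => hagree _ (htgt j (by omega) (by omega))
  -- the loop corners' targets are not `e` (except at `p₂` itself)
  have hLtgt : ∀ m, 0 < m → m < Q → cTgt (cornerOrbit β p₂ m) ≠ cTgt p := by
    intro m hm hmQ h
    rcases cTgt_eq_cTgt_iff.1 h with h | h
    · exact hdisj m i₁ (h.trans hi₁.symm)
    · exact hQmin m hm hmQ h
  -- Umlaufsatz for `L` (in `β`): the turns after the first sum to `±4 - 1`
  have hU := hT2 β p₂ Q hQ0 hQ hQmin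
  rw [show Q = (Q - 1) + 1 by omega, Finset.sum_range_succ'] at hU
  have hs0 : turnSign β (cornerOrbit β p₂ 0) = 1 := turnSign_of_not_mem (by
    change cTgt p₂ ∉ β; rwa [hp₂, cTgt_partner])
  rw [hs0] at hU
  -- the turn count at the second arrival of `ω ∪ e`
  have hC₂ : turnCount β' c₀ (i₁ + Q) = turnCount β c₀ i₁ - 1 +
      ∑ m ∈ Finset.range (Q - 1), turnSign β (cornerOrbit β p₂ (m + 1)) := by
    rw [turnCount_add, show Q = (Q - 1) + 1 by omega, Finset.sum_range_succ', Nat.sub_add_cancel hQ0, add_zero, hpre i₁ le_rfl,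
      hi₁, turnSign_of_mem he', hC]
    have hterm : ∀ m ∈ Finset.range (Q - 1), turnSign β' (orb' (i₁ + (m + 1))) = turnSign β (cornerOrbit β p₂ (m + 1)) := by
      intro m hm
      rw [Finset.mem_range] at hm
      rw [show i₁ + (m + 1) = i₁ + 1 + m by omega, hloop m (by omega)]
      exact turnSign_congr (hagree _ (hLtgt (m + 1) (Nat.succ_pos _) (by omega)))
    rw [Finset.sum_congr rfl hterm]
    ring
  have hphase : eighthPhase (2 * turnCount β' c₀ (i₁ + Q)) = eighthPhase (2 * turnCount β c₀ i₁) * eighthPhase 4 := by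
    rw [← eighthPhase_add, hC₂]
    rcases hU with hU | hU
    · have hS : ∑ m ∈ Finset.range (Q - 1), turnSign β (cornerOrbit β p₂ (m + 1)) = 3 := by omega
      rw [hS, show 2 * (turnCount β c₀ i₁ - 1 + 3) = 2 * turnCount β c₀ i₁ - 4 + 8 by ring, (eighthPhase_shift_pm8' _).1]
    · have hS : ∑ m ∈ Finset.range (Q - 1), turnSign β (cornerOrbit β p₂ (m + 1)) = -5 := by omega
      rw [hS, show 2 * (turnCount β c₀ i₁ - 1 + -5) = 2 * turnCount β c₀ i₁ - 4 - 8 by ring, (eighthPhase_shift_pm8' _).2]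
  -- assemble
  rw [arrivalSum, hfilt, Finset.sum_singleton, arrivalSum, hfilt', Finset.sum_pair (by omega : i₁ ≠ i₁ + Q), hi₁,
    hpre i₁ le_rfl, hi₁, hloopQ, turnSign_of_not_mem he, turnSign_of_mem he',
    turnSign_of_mem (show cTgt p₂ ∈ β' by rwa [hp₂, cTgt_partner]), hC, hphase]
  linear_combination hφ1 (eighthPhase (2 * turnCount β c₀ i₁))

end Cases

/-! ### The weighted pair identity and its sum, weak hypotheses -/

section Weighted

variable {D : DiscreteDobrushin}

open scoped Classical in
/-- **The weighted pair identity, weak hypotheses** (`pair_weighted` with "all faces at the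
endpoints inner" replaced by "the two faces of `e` — the faces of `p` and of its partner — are
inner"). [cite: Smirnov2010, proof of Lemma 4.5] -/
theorem pair_weighted_free (hD : D.IsZdAdmissible) [Fintype (meshDomain D.Ω D.δ)]
    (hA : ((discreteDomainGraph D.Ω D.δ).induce D.zdArcA).Preconnected)
    (hT1 : medialCycle_separates) (hT2 : medialCycle_turning) {p : Site 2 × Fin 4}
    (hpf : D.IsInnerFace (cFace p)) (hp₂f : D.IsInnerFace (cFace (cornerPartner p)))
    (φ : ℤ → ℂ) (hφ1 : ∀ a : ℂ, (Real.sqrt 2 : ℂ) * (a * φ 1) + (a * φ (-1) + a * eighthPhase 4 * φ (-1)) = 0)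
    (hφ2 : ∀ a : ℂ, a * φ 1 + a * eighthPhase (-4) * φ 1 + (Real.sqrt 2 : ℂ) * (a * φ (-1)) = 0)
    {u v : meshDomain D.Ω D.δ} (hu : u.val = p.1) (hv : v.val = p.1 + cornerUnit (p.2 + 1))
    (heG : s(u, v) ∈ D.interfaceGraph.edgeFinset) (hpA : ¬ (p.1 ∈ D.zdArcA ∧ p.1 + cornerUnit (p.2 + 1) ∈ D.zdArcA))
    {ω : Finset (Sym2 (meshDomain D.Ω D.δ))} (hω : ω ⊆ D.interfaceGraph.edgeFinset) (heω : s(u, v) ∉ ω) :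
    (rcWeight D.interfaceGraph criticalFKIsingParam 2 (Subtype.val ⁻¹' D.zdArcA) ω : ℂ) *
        arrivalSum φ (D.bcBondConfig (liftConfig D.Ω D.δ ω)) (DiscreteDobrushin.startCorner hD) p
          (DiscreteDobrushin.exitTime hD (liftConfig D.Ω D.δ ω)) +
      (rcWeight D.interfaceGraph criticalFKIsingParam 2 (Subtype.val ⁻¹' D.zdArcA) (insert s(u, v) ω) : ℂ) *
        arrivalSum φ (D.bcBondConfig (liftConfig D.Ω D.δ (insert s(u, v) ω))) (DiscreteDobrushin.startCorner hD) p
          (DiscreteDobrushin.exitTime hD (liftConfig D.Ω D.δ (insert s(u, v) ω))) = 0 := by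
  -- notation and basic data
  set c₀ := DiscreteDobrushin.startCorner hD with hc₀def
  have hc₀ : D.IsStartCorner c₀ := DiscreteDobrushin.isStartCorner_startCorner hD
  set β := D.bcBondConfig (liftConfig D.Ω D.δ ω) with hβ
  set β' := D.bcBondConfig (liftConfig D.Ω D.δ (insert s(u, v) ω)) with hβ'
  set N := DiscreteDobrushin.exitTime hD (liftConfig D.Ω D.δ ω) with hNdef
  have hN : ¬ D.IsInnerFace (cFace (cornerOrbit β c₀ N)) := DiscreteDobrushin.not_isInnerFace_exitTime hD _
  have hlt : ∀ k < N, D.IsInnerFace (cFace (cornerOrbit β c₀ k)) := fun k hk =>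
    DiscreteDobrushin.isInnerFace_of_lt_exitTime hD _ hk
  have hpe : cTgt p = Sym2.map Subtype.val s(u, v) := by rw [Sym2.map_mk, hu, hv]; rfl
  have heG' := interfaceGraph_edge (D := D) (SimpleGraph.mem_edgeFinset.1 heG)
  have hpA' : ¬ ∀ x ∈ Sym2.map Subtype.val s(u, v), x ∈ D.zdArcA := by
    intro h; rw [← hpe] at h
    exact hpA ⟨h _ (Sym2.mem_mk_left _ _), h _ (Sym2.mem_mk_right _ _)⟩
  -- the endpoints of `e` are off the arc `B`
  have hxB : p.1 ∉ D.zdArcB := by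
    have := heG'.2 u.val (by rw [Sym2.map_mk]; exact Sym2.mem_mk_left _ _); rwa [hu] at this
  have hyB : p.1 + cornerUnit (p.2 + 1) ∉ D.zdArcB := by
    have := heG'.2 v.val (by rw [Sym2.map_mk]; exact Sym2.mem_mk_right _ _); rwa [hv] at this
  obtain ⟨hagree, hdiff⟩ := DiscreteDobrushin.toggle_hypotheses heG'.1 heG'.2 hpA' heω hpe
  have he : cTgt p ∉ β := by rw [hpe]; exact DiscreteDobrushin.map_not_mem_bcBondConfig_liftConfig heω hpA'
  have hωE : ∀ e ∈ ω, Sym2.map Subtype.val e ∈ (discreteDomainGraph D.Ω D.δ).edgeSet ∧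
      ∀ x ∈ Sym2.map Subtype.val e, x ∉ D.zdArcB := fun e he => interfaceGraph_edge (SimpleGraph.mem_edgeFinset.1 (hω he))
  -- the FK weight of `ω ∪ e`
  have hW := rcWeight_insert_critical (G := D.interfaceGraph) (Subtype.val ⁻¹' D.zdArcA) heG heω
  set w := rcWeight D.interfaceGraph criticalFKIsingParam 2 (Subtype.val ⁻¹' D.zdArcA) ω with hwdef
  have hs2 : (Real.sqrt 2 : ℂ) * (Real.sqrt 2 : ℂ) = 2 := by
    rw [← Complex.ofReal_mul, Real.mul_self_sqrt zero_le_two]; norm_num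
  -- wired reachability of the endpoints = reachability in the completed configuration ((H1))
  have hreach_iff : (Percolation.openGraph (↑ω : Percolation.BondConfig (meshDomain D.Ω D.δ)) ⊔
      wired (Subtype.val ⁻¹' D.zdArcA)).Reachable u v ↔ (Percolation.openGraph β).Reachable p.1 (p.1 + cornerUnit (p.2 + 1)) := by
    constructor
    · intro h
      have := DiscreteDobrushin.reachable_bc_of_reachable_wired hA hωE h
      rwa [hu, hv] at this
    · intro h
      have h' : (Percolation.openGraph β).Reachable u.val v.val := by rwa [hu, hv]
      exact DiscreteDobrushin.reachable_wired_of_reachable_bc u.2 v.2 h'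
  -- symmetric versions of the toggling hypotheses (for the partner)
  have hagree2 : ∀ e, e ≠ cTgt (cornerPartner p) → (e ∈ β' ↔ e ∈ β) := by rw [cTgt_partner]; exact hagree
  have hdiff2 : ¬ (cTgt (cornerPartner p) ∈ β' ↔ cTgt (cornerPartner p) ∈ β) := by rw [cTgt_partner]; exact hdiff
  have he2 : cTgt (cornerPartner p) ∉ β := by rw [cTgt_partner]; exact he
  have hpp : ∀ i j, cornerOrbit β c₀ i = p → cornerOrbit β c₀ j = cornerPartner p → i ≠ j := by
    rintro i j hi hj rfl; exact partner_ne p (hj.symm.trans hi)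
  -- face and arc data for the partner
  have hyx : (cornerPartner p).1 + cornerUnit ((cornerPartner p).2 + 1) = p.1 := by
    change p.1 + cornerUnit (p.2 + 1) + cornerUnit (p.2 + 2 + 1) = p.1
    rw [show p.2 + 2 + 1 = (p.2 + 1) + 2 by omega, cornerUnit_add_two]; abel
  have hpf' : D.IsInnerFace (cFace (cornerPartner p)) := hp₂f
  have hp₂f' : D.IsInnerFace (cFace (cornerPartner (cornerPartner p))) := by rw [partner_partner]; exact hpf
  have hpB' : (cornerPartner p).1 + cornerUnit ((cornerPartner p).2 + 1) ∉ D.zdArcB := by rw [hyx]; exact hxB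
  by_cases h₁ : ∃ i, i < N ∧ cornerOrbit β c₀ i = p
  · by_cases h₂ : ∃ i, i < N ∧ cornerOrbit β c₀ i = cornerPartner p
    · -- case 2: both corners arrive; the endpoints are joined, weight ratio `√2`
      obtain ⟨i₁, hi₁N, hi₁⟩ := h₁
      obtain ⟨i₂, hi₂N, hi₂⟩ := h₂
      have hR := hreach_iff.2 (reachable_of_both_arrive β c₀ hi₁ hi₂)
      rw [if_pos hR] at hW
      rcases Nat.lt_or_gt_of_ne (hpp i₁ i₂ hi₁ hi₂) with h12 | h12
      · have hX := arrivalSum_case2 hD hc₀ hagree hdiff he hT2 hlt hi₁ hi₂ h12 hi₂N φ hφ2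
        have hex := exit_toggle_case2 hD hc₀ hagree hdiff hN hlt hi₁ hi₂ h12 hi₂N
        rw [exitTime_eq_of hD _ hex.1 hex.2, hW]
        push_cast
        linear_combination (w : ℂ) * hX
      · have hX := arrivalSum_case2 (p := cornerPartner p) hD hc₀ hagree2 hdiff2 he2 hT2 hlt hi₂
          (by rw [partner_partner]; exact hi₁) h12 hi₁N φ hφ2
        rw [arrivalSum_partner, arrivalSum_partner] at hX
        have hex := exit_toggle_case2 (p := cornerPartner p) hD hc₀ hagree2 hdiff2 hN hlt hi₂
          (by rw [partner_partner]; exact hi₁) h12 hi₁N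
        rw [exitTime_eq_of hD _ hex.1 hex.2, hW]
        push_cast
        linear_combination (w : ℂ) * hX
    · -- case 1 for `p`: its partner never arrives; the endpoints are separated (T1), ratio `1/√2`
      obtain ⟨i₁, hi₁N, hi₁⟩ := h₁
      have h₂' : ∀ i < N, cornerOrbit β c₀ i ≠ cornerPartner p := fun i hi h => h₂ ⟨i, hi, h⟩
      have hc₀m : c₀.1 ∈ meshDomain D.Ω D.δ := D.zdBoundary_subset_meshDomain (D.zdArcA_subset_zdBoundary hc₀.mem_zdArcA)
      obtain ⟨P, hP0, hP, hPmin⟩ := exists_min_period hD (liftConfig D.Ω D.δ ω) hc₀m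
      have hym : (cornerPartner p).1 ∈ meshDomain D.Ω D.δ := by
        change p.1 + cornerUnit (p.2 + 1) ∈ _; rw [← hv]; exact v.2
      obtain ⟨Q, hQ0, hQ, hQmin⟩ := exists_min_period hD (liftConfig D.Ω D.δ ω) hym
      have hX := arrivalSum_case1_free hD hc₀ hagree hdiff he hT2 hpf hp₂f hyB hN hlt hP0 hP hPmin hQ0 hQ hQmin hi₁ hi₁N
        h₂' φ hφ1
      have hL : ∀ m, cornerOrbit β (cornerPartner p) m ≠ p := by
        intro m h
        obtain ⟨s', hs'⟩ := exists_eq_cornerOrbit_of_iterate hP0 hP m (h.trans hi₁.symm)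
        have hin : D.IsInnerFace (cFace (cornerOrbit β c₀ s')) := hs' ▸ hp₂f
        rw [isInnerFace_cornerOrbit_iff hD hc₀ hN hlt hP0 hP hPmin] at hin
        exact h₂' _ hin (by rw [cornerOrbit_mod_period hP]; exact hs'.symm)
      have hnR : ¬ (Percolation.openGraph β).Reachable p.1 (p.1 + cornerUnit (p.2 + 1)) :=
        hT1 β (bcBondConfig_subset_zd _) p he Q hQ0 hQ hL
      rw [if_neg (fun h => hnR (hreach_iff.1 h))] at hW
      obtain ⟨-, -, -, hin', hout'⟩ := cornerOrbit_toggle_case1_free hD hc₀ hagree hdiff hpf hp₂f hyB hN hlt hP0 hP hPmin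
        hQ0 hQ hQmin hi₁ hi₁N h₂'
      rw [exitTime_eq_of hD _ hout' hin', hW]
      push_cast
      linear_combination ((w : ℂ) * Real.sqrt 2 / 2) * hX -
        ((w : ℂ) * arrivalSum φ β c₀ p N / 2) * hs2
  · have h₁' : ∀ i < N, cornerOrbit β c₀ i ≠ p := fun i hi h => h₁ ⟨i, hi, h⟩
    by_cases h₂ : ∃ i, i < N ∧ cornerOrbit β c₀ i = cornerPartner p
    · -- case 1 for the partner
      obtain ⟨i₂, hi₂N, hi₂⟩ := h₂
      have hc₀m : c₀.1 ∈ meshDomain D.Ω D.δ := D.zdBoundary_subset_meshDomain (D.zdArcA_subset_zdBoundary hc₀.mem_zdArcA)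
      obtain ⟨P, hP0, hP, hPmin⟩ := exists_min_period hD (liftConfig D.Ω D.δ ω) hc₀m
      have hxm : (cornerPartner (cornerPartner p)).1 ∈ meshDomain D.Ω D.δ := by
        rw [partner_partner, ← hu]; exact u.2
      obtain ⟨Q, hQ0, hQ, hQmin⟩ := exists_min_period hD (liftConfig D.Ω D.δ ω) hxm
      have h₁'' : ∀ i < N, cornerOrbit β c₀ i ≠ cornerPartner (cornerPartner p) := by
        rw [partner_partner]; exact h₁'
      have hX := arrivalSum_case1_free (p := cornerPartner p) hD hc₀ hagree2 hdiff2 he2 hT2 hpf' hp₂f' hpB' hN hlt hP0 hP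
        hPmin hQ0 hQ hQmin hi₂ hi₂N h₁'' φ hφ1
      rw [arrivalSum_partner, arrivalSum_partner] at hX
      have hL : ∀ m, cornerOrbit β (cornerPartner (cornerPartner p)) m ≠ cornerPartner p := by
        intro m h
        obtain ⟨s', hs'⟩ := exists_eq_cornerOrbit_of_iterate hP0 hP m (h.trans hi₂.symm)
        have hin : D.IsInnerFace (cFace (cornerOrbit β c₀ s')) := hs' ▸ hp₂f'
        rw [isInnerFace_cornerOrbit_iff hD hc₀ hN hlt hP0 hP hPmin] at hin
        exact h₁'' _ hin (by rw [cornerOrbit_mod_period hP]; exact hs'.symm)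
      have hnR' := hT1 β (bcBondConfig_subset_zd _) (cornerPartner p) he2 Q hQ0 hQ hL
      rw [hyx] at hnR'
      have hnR : ¬ (Percolation.openGraph β).Reachable p.1 (p.1 + cornerUnit (p.2 + 1)) := fun h => hnR' h.symm
      rw [if_neg (fun h => hnR (hreach_iff.1 h))] at hW
      obtain ⟨-, -, -, hin', hout'⟩ := cornerOrbit_toggle_case1_free (p := cornerPartner p) hD hc₀ hagree2 hdiff2 hpf' hp₂f'
        hpB' hN hlt hP0 hP hPmin hQ0 hQ hQmin hi₂ hi₂N h₁''
      rw [exitTime_eq_of hD _ hout' hin', hW]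
      push_cast
      linear_combination ((w : ℂ) * Real.sqrt 2 / 2) * hX -
        ((w : ℂ) * arrivalSum φ β c₀ p N / 2) * hs2
    · -- case 0: no arrival at all
      have h₂' : ∀ i < N, cornerOrbit β c₀ i ≠ cornerPartner p := fun i hi h => h₂ ⟨i, hi, h⟩
      obtain ⟨h0, h0'⟩ := arrivalSum_case0 (c₀ := c₀) hagree hdiff h₁' h₂' φ
      have hcase := cornerOrbit_toggle_case0 (c₀ := c₀) hagree hdiff h₁' h₂'
      have hN' : DiscreteDobrushin.exitTime hD (liftConfig D.Ω D.δ (insert s(u, v) ω)) = N := by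
        refine exitTime_eq_of hD _ ?_ fun k hk => ?_
        · rw [hcase N le_rfl]; exact hN
        · rw [hcase k hk.le]; exact hlt k hk
      rw [hN', h0, h0']
      ring

open scoped Classical in
/-- **Summing the pair identities, weak hypotheses.** [cite: Smirnov2010, proof of Lemma 4.5] -/
theorem sum_weighted_arrivalSum_free (hD : D.IsZdAdmissible) [Fintype (meshDomain D.Ω D.δ)]
    (hA : ((discreteDomainGraph D.Ω D.δ).induce D.zdArcA).Preconnected)
    (hT1 : medialCycle_separates) (hT2 : medialCycle_turning) {p : Site 2 × Fin 4}
    (hpf : D.IsInnerFace (cFace p)) (hp₂f : D.IsInnerFace (cFace (cornerPartner p)))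
    (φ : ℤ → ℂ) (hφ1 : ∀ a : ℂ, (Real.sqrt 2 : ℂ) * (a * φ 1) + (a * φ (-1) + a * eighthPhase 4 * φ (-1)) = 0)
    (hφ2 : ∀ a : ℂ, a * φ 1 + a * eighthPhase (-4) * φ 1 + (Real.sqrt 2 : ℂ) * (a * φ (-1)) = 0)
    {u v : meshDomain D.Ω D.δ} (hu : u.val = p.1) (hv : v.val = p.1 + cornerUnit (p.2 + 1))
    (heG : s(u, v) ∈ D.interfaceGraph.edgeFinset) (hpA : ¬ (p.1 ∈ D.zdArcA ∧ p.1 + cornerUnit (p.2 + 1) ∈ D.zdArcA)) :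
    ∑ ω ∈ D.interfaceGraph.edgeFinset.powerset,
      (rcWeight D.interfaceGraph criticalFKIsingParam 2 (Subtype.val ⁻¹' D.zdArcA) ω : ℂ) *
        arrivalSum φ (D.bcBondConfig (liftConfig D.Ω D.δ ω)) (DiscreteDobrushin.startCorner hD) p
          (DiscreteDobrushin.exitTime hD (liftConfig D.Ω D.δ ω)) = 0 := by
  rw [sum_powerset_pair heG]
  refine Finset.sum_eq_zero fun ω hω => ?_
  rw [Finset.mem_powerset] at hω
  have hωE : ω ⊆ D.interfaceGraph.edgeFinset := hω.trans (Finset.erase_subset _ _)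
  have heω : s(u, v) ∉ ω := fun h => Finset.notMem_erase _ _ (hω h)
  exact pair_weighted_free hD hA hT1 hT2 hpf hp₂f φ hφ1 hφ2 hu hv heG hpA hωE heω

end Weighted

/-! ### Lemma 4.5 at every interior medial vertex -/

section Observables

variable {D : DiscreteDobrushin}

/-- The subtype data of an edge of `Ω_δ` avoiding the arc `B`, written as `cTgt p`: its endpoints
as vertices of `Ω_δ`, the edge of the interface graph they span, and "no endpoint on `B`".
[cite: Smirnov2010, §2.1] -/
theorem free_data [Fintype (meshDomain D.Ω D.δ)] [DecidableRel D.interfaceGraph.Adj] {p : Site 2 × Fin 4}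
    (he : cTgt p ∈ (discreteDomainGraph D.Ω D.δ).edgeSet) (hB : ∀ x ∈ cTgt p, x ∉ D.zdArcB) :
    ∃ u v : meshDomain D.Ω D.δ, u.val = p.1 ∧ v.val = p.1 + cornerUnit (p.2 + 1) ∧
      s(u, v) ∈ D.interfaceGraph.edgeFinset := by
  have hadj : (discreteDomainGraph D.Ω D.δ).Adj p.1 (p.1 + cornerUnit (p.2 + 1)) := he
  have h1 : p.1 ∈ cTgt p := by rw [cTgt]; exact Sym2.mem_mk_left _ _
  have h2 : p.1 + cornerUnit (p.2 + 1) ∈ cTgt p := by rw [cTgt]; exact Sym2.mem_mk_right _ _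
  exact ⟨⟨p.1, mem_meshDomain_of_mem_edge he h1⟩, ⟨p.1 + cornerUnit (p.2 + 1), mem_meshDomain_of_mem_edge he h2⟩,
    rfl, rfl, mem_interfaceGraph_edgeFinset hadj (hB _ h1) (hB _ h2)⟩

open scoped Classical in
/-- **The incoming identity at every interior medial vertex** (Smirnov 2010, proof of Lemma 4.5,
"`F(N) + F(S) = F(v)`", weak hypotheses): for admissible data with connected wired arc (H1), at an
edge `e = cTgt p` of `Ω_δ` with no endpoint on `B`, not an `A`–`A` edge, whose two faces (the faces
of `p` and of its partner) are inner, the dart observables of the two corners arriving at `e` add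
up to `κ F(e)`. The edges with an endpoint on the wired arc `A` are included.
[cite: Smirnov2010, Lemma 4.5 with Remarks 4.6–4.7] -/
theorem dartObs_add_dartObs_partner_free (hD : D.IsZdAdmissible) [Fintype (meshDomain D.Ω D.δ)]
    (hA : ((discreteDomainGraph D.Ω D.δ).induce D.zdArcA).Preconnected) {p : Site 2 × Fin 4}
    (he : cTgt p ∈ (discreteDomainGraph D.Ω D.δ).edgeSet) (hB : ∀ x ∈ cTgt p, x ∉ D.zdArcB)
    (hpA : ¬ (p.1 ∈ D.zdArcA ∧ p.1 + cornerUnit (p.2 + 1) ∈ D.zdArcA))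
    (hpf : D.IsInnerFace (cFace p)) (hp₂f : D.IsInnerFace (cFace (cornerPartner p))) :
    dartObs D hD p + dartObs D hD (cornerPartner p) = kappa * fkIsingObservable D criticalFKIsingParam (cTgt p) := by
  obtain ⟨u, v, hu, hv, heG⟩ := free_data he hB
  have hS := sum_weighted_arrivalSum_free hD hA medialCycle_separates_holds medialCycle_turning_holds hpf hp₂f
    (fun s => 1 - kappa * eighthPhase s) (fun a => table_case1 a) (fun a => table_case2 a) hu hv heG hpA
  simp only [arrivalSum_in_eq hD hB] at hS
  have hZ := rcPartitionFunction_pos D.interfaceGraph criticalFKIsingParam_mem_Icc two_pos (Subtype.val ⁻¹' D.zdArcA)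
  rw [fkIsingObservable_eq_sum hD, dartObs, dartObs, ← Finset.sum_add_distrib, Finset.mul_sum]
  rw [← sub_eq_zero, ← Finset.sum_sub_distrib]
  set Z := rcPartitionFunction D.interfaceGraph criticalFKIsingParam 2 (Subtype.val ⁻¹' D.zdArcA) with hZdef
  calc _ = (Z : ℂ)⁻¹ * ∑ ω ∈ D.interfaceGraph.edgeFinset.powerset,
        (rcWeight D.interfaceGraph criticalFKIsingParam 2 (Subtype.val ⁻¹' D.zdArcA) ω : ℂ) *
          ((∑ j ∈ (Finset.range (DiscreteDobrushin.exitTime hD (liftConfig D.Ω D.δ ω))).filter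
              (fun j => cornerOrbit (D.bcBondConfig (liftConfig D.Ω D.δ ω)) (DiscreteDobrushin.startCorner hD) j = p),
            quarterPhase (turnCount (D.bcBondConfig (liftConfig D.Ω D.δ ω)) (DiscreteDobrushin.startCorner hD) j)) +
          (∑ j ∈ (Finset.range (DiscreteDobrushin.exitTime hD (liftConfig D.Ω D.δ ω))).filter
              (fun j => cornerOrbit (D.bcBondConfig (liftConfig D.Ω D.δ ω)) (DiscreteDobrushin.startCorner hD) j = cornerPartner p),
            quarterPhase (turnCount (D.bcBondConfig (liftConfig D.Ω D.δ ω)) (DiscreteDobrushin.startCorner hD) j)) -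
          kappa * passageSum (explorationList (D.bcBondConfig (liftConfig D.Ω D.δ ω)) (DiscreteDobrushin.startCorner hD)
            (DiscreteDobrushin.exitTime hD (liftConfig D.Ω D.δ ω))) D.δ (1 / 2) (cTgt p)) := by
          rw [Finset.mul_sum]
          refine Finset.sum_congr rfl fun ω _ => ?_
          rw [Complex.real_smul]
          push_cast
          have hZ' : (Z : ℂ) ≠ 0 := by exact_mod_cast hZ.ne'
          field_simp
    _ = 0 := by rw [hS, mul_zero]

open scoped Classical in
/-- **The outgoing identity at every interior medial vertex** (Smirnov 2010, proof of Lemma 4.5,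
"`F(E) + F(W) = F(v)`", weak hypotheses): under the hypotheses of
`dartObs_add_dartObs_partner_free`, the dart observables of the two corners leaving `e = cTgt p`
add up to `κ F(e)`. [cite: Smirnov2010, Lemma 4.5 with Remarks 4.6–4.7] -/
theorem dartObs_out_free (hD : D.IsZdAdmissible) [Fintype (meshDomain D.Ω D.δ)]
    (hA : ((discreteDomainGraph D.Ω D.δ).induce D.zdArcA).Preconnected) {p : Site 2 × Fin 4}
    (he : cTgt p ∈ (discreteDomainGraph D.Ω D.δ).edgeSet) (hB : ∀ x ∈ cTgt p, x ∉ D.zdArcB)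
    (hpA : ¬ (p.1 ∈ D.zdArcA ∧ p.1 + cornerUnit (p.2 + 1) ∈ D.zdArcA))
    (hpf : D.IsInnerFace (cFace p)) (hp₂f : D.IsInnerFace (cFace (cornerPartner p))) :
    dartObs D hD (p.1, p.2 + 1) + dartObs D hD (p.1 + cornerUnit (p.2 + 1), p.2 + 3) =
      kappa * fkIsingObservable D criticalFKIsingParam (cTgt p) := by
  obtain ⟨u, v, hu, hv, heG⟩ := free_data he hB
  have hφ1 : ∀ a : ℂ, (Real.sqrt 2 : ℂ) * (a * (fun s : ℤ => eighthPhase (2 * s) - kappa * eighthPhase s) 1) +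
      (a * (fun s : ℤ => eighthPhase (2 * s) - kappa * eighthPhase s) (-1) +
        a * eighthPhase 4 * (fun s : ℤ => eighthPhase (2 * s) - kappa * eighthPhase s) (-1)) = 0 := by
    intro a; simpa using table_case1_out a
  have hφ2 : ∀ a : ℂ, a * (fun s : ℤ => eighthPhase (2 * s) - kappa * eighthPhase s) 1 +
      a * eighthPhase (-4) * (fun s : ℤ => eighthPhase (2 * s) - kappa * eighthPhase s) 1 +
        (Real.sqrt 2 : ℂ) * (a * (fun s : ℤ => eighthPhase (2 * s) - kappa * eighthPhase s) (-1)) = 0 := by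
    intro a; simpa using table_case2_out a
  have hS := sum_weighted_arrivalSum_free hD hA medialCycle_separates_holds medialCycle_turning_holds hpf hp₂f
    (fun s => eighthPhase (2 * s) - kappa * eighthPhase s) hφ1 hφ2 hu hv heG hpA
  simp only [arrivalSum_out_eq hD hB] at hS
  have hZ := rcPartitionFunction_pos D.interfaceGraph criticalFKIsingParam_mem_Icc two_pos (Subtype.val ⁻¹' D.zdArcA)
  rw [fkIsingObservable_eq_sum hD, dartObs, dartObs, ← Finset.sum_add_distrib, Finset.mul_sum]
  rw [← sub_eq_zero, ← Finset.sum_sub_distrib]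
  set Z := rcPartitionFunction D.interfaceGraph criticalFKIsingParam 2 (Subtype.val ⁻¹' D.zdArcA) with hZdef
  calc _ = (Z : ℂ)⁻¹ * ∑ ω ∈ D.interfaceGraph.edgeFinset.powerset,
        (rcWeight D.interfaceGraph criticalFKIsingParam 2 (Subtype.val ⁻¹' D.zdArcA) ω : ℂ) *
          ((∑ j ∈ (Finset.range (DiscreteDobrushin.exitTime hD (liftConfig D.Ω D.δ ω))).filter
              (fun j => cornerOrbit (D.bcBondConfig (liftConfig D.Ω D.δ ω)) (DiscreteDobrushin.startCorner hD) j = (p.1, p.2 + 1)),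
            quarterPhase (turnCount (D.bcBondConfig (liftConfig D.Ω D.δ ω)) (DiscreteDobrushin.startCorner hD) j)) +
          (∑ j ∈ (Finset.range (DiscreteDobrushin.exitTime hD (liftConfig D.Ω D.δ ω))).filter
              (fun j => cornerOrbit (D.bcBondConfig (liftConfig D.Ω D.δ ω)) (DiscreteDobrushin.startCorner hD) j =
                (p.1 + cornerUnit (p.2 + 1), p.2 + 3)),
            quarterPhase (turnCount (D.bcBondConfig (liftConfig D.Ω D.δ ω)) (DiscreteDobrushin.startCorner hD) j)) -
          kappa * passageSum (explorationList (D.bcBondConfig (liftConfig D.Ω D.δ ω)) (DiscreteDobrushin.startCorner hD)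
            (DiscreteDobrushin.exitTime hD (liftConfig D.Ω D.δ ω))) D.δ (1 / 2) (cTgt p)) := by
          rw [Finset.mul_sum]
          refine Finset.sum_congr rfl fun ω _ => ?_
          rw [Complex.real_smul]
          push_cast
          have hZ' : (Z : ℂ) ≠ 0 := by exact_mod_cast hZ.ne'
          field_simp
    _ = 0 := by rw [hS, mul_zero]

end Observables

/-! ## Part 2. The dart fluxes `|F(e)|²` -/

section Flux

variable {D : DiscreteDobrushin}

open Complex

/-- **Smirnov's increment `|F(e)|²` of the discrete primitive across a medial edge** (Lemma 3.6,
eq. (3.3): "`H(B) - H(W) = |F(e)|²`"), for the critical FK-Ising observable of admissible data: the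
squared norm of the dart observable `dartObs D hD q` (the edge observable `F(e)` of §4 at the
medial edge `q`, normalisation `κ = cos(π/8)` included). Nonnegative; the primitive increases from
the vertex `q.1` to the face `cFace q`. [cite: Smirnov2010, Lemma 3.6 eq. (3.3)] -/
def dartFlux (D : DiscreteDobrushin) [Fintype (meshDomain D.Ω D.δ)] (hD : D.IsZdAdmissible)
    (q : Site 2 × Fin 4) : ℝ :=
  ‖dartObs D hD q‖ ^ 2

/-- Fluxes are nonnegative. [cite: Smirnov2010, Remark 3.9] -/
theorem dartFlux_nonneg [Fintype (meshDomain D.Ω D.δ)] (hD : D.IsZdAdmissible) (q : Site 2 × Fin 4) :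
    0 ≤ dartFlux D hD q := sq_nonneg _

/-- **Pythagoras on two orthogonal lines**: if `a ∈ η ℝ` and `b ∈ (iη) ℝ` with `‖η‖ = 1`, then
`‖a + b‖² = ‖a‖² + ‖b‖²`. [folklore] -/
theorem norm_sq_add_of_orthogonal_lines {a b η : ℂ} (hη : ‖η‖ = 1) {t t' : ℝ} (ha : a = t * η)
    (hb : b = t' * (I * η) ∨ b = -(t' * (I * η))) : ‖a + b‖ ^ 2 = ‖a‖ ^ 2 + ‖b‖ ^ 2 := by
  have key : ∀ s : ℝ, ‖(t : ℂ) * η + s * (I * η)‖ ^ 2 = ‖(t : ℂ) * η‖ ^ 2 + ‖(s : ℂ) * (I * η)‖ ^ 2 := by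
    intro s
    rw [show (t : ℂ) * η + s * (I * η) = (t + s * I) * η by ring, norm_mul, norm_mul, norm_mul, norm_mul, hη,
      norm_I, mul_one, mul_one, one_mul, Complex.norm_real, Complex.norm_real, mul_pow, Complex.sq_norm,
      Complex.normSq_apply]
    simp only [add_re, ofReal_re, mul_re, I_re, mul_zero, ofReal_im, I_im, mul_one, sub_self, add_zero,
      add_im, mul_im, zero_add]
    rw [Real.norm_eq_abs, Real.norm_eq_abs, sq_abs, sq_abs]; ring
  rcases hb with hb | hb
  · rw [ha, hb]; exact key t'
  · rw [ha, hb, show -((t' : ℂ) * (I * η)) = ((-t' : ℝ) : ℂ) * (I * η) by push_cast; ring]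
    rw [key (-t')]

/-- The fluxes of two darts two faces apart (perpendicular lines, Lemma 4.1) add up to the squared
norm of the sum of their observables. [cite: Smirnov2010, Lemma 4.1] -/
theorem dartFlux_add_of_snd_eq [Fintype (meshDomain D.Ω D.δ)] (hD : D.IsZdAdmissible) (q q' : Site 2 × Fin 4)
    (h : q'.2 = q.2 + 2) :
    dartFlux D hD q + dartFlux D hD q' = ‖dartObs D hD q + dartObs D hD q'‖ ^ 2 := by
  obtain ⟨t, ht⟩ := dartObs_mem_line hD q
  obtain ⟨t', ht'⟩ := dartObs_mem_line hD q'
  have hη : ‖quarterPhase (dartDir (DiscreteDobrushin.startCorner hD) q)‖ = 1 := norm_quarterPhase _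
  unfold dartFlux
  rcases quarterPhase_dartDir_add_two (DiscreteDobrushin.startCorner hD) q q' h with h2 | h2
  · rw [h2] at ht'
    exact (norm_sq_add_of_orthogonal_lines hη ht (Or.inl ht')).symm
  · rw [h2, mul_neg] at ht'
    exact (norm_sq_add_of_orthogonal_lines hη ht (Or.inr ht')).symm

/-- **Incoming fluxes** (Lemma 3.6 with Lemma 4.5, weak hypotheses): at an interior medial vertex
`e = cTgt p` (edge of `Ω_δ` with no endpoint on `B`, not `A`–`A`, both faces inner; (H1)), the fluxes
of the two arriving darts add up to `|κ F(e)|²`. [cite: Smirnov2010, proof of Lemma 3.6] -/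
theorem dartFlux_in_eq [Fintype (meshDomain D.Ω D.δ)] (hD : D.IsZdAdmissible)
    (hA : ((discreteDomainGraph D.Ω D.δ).induce D.zdArcA).Preconnected) {p : Site 2 × Fin 4}
    (he : cTgt p ∈ (discreteDomainGraph D.Ω D.δ).edgeSet) (hB : ∀ x ∈ cTgt p, x ∉ D.zdArcB)
    (hpA : ¬ (p.1 ∈ D.zdArcA ∧ p.1 + cornerUnit (p.2 + 1) ∈ D.zdArcA))
    (hpf : D.IsInnerFace (cFace p)) (hp₂f : D.IsInnerFace (cFace (cornerPartner p))) :
    dartFlux D hD p + dartFlux D hD (cornerPartner p) =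
      ‖kappa * fkIsingObservable D criticalFKIsingParam (cTgt p)‖ ^ 2 := by
  rw [dartFlux_add_of_snd_eq hD p (cornerPartner p) rfl, dartObs_add_dartObs_partner_free hD hA he hB hpA hpf hp₂f]

/-- **Outgoing fluxes** (Lemma 3.6 with Lemma 4.5, weak hypotheses): at an interior medial vertex
the fluxes of the two leaving darts add up to `|κ F(e)|²`. [cite: Smirnov2010, proof of Lemma 3.6] -/
theorem dartFlux_out_eq [Fintype (meshDomain D.Ω D.δ)] (hD : D.IsZdAdmissible)
    (hA : ((discreteDomainGraph D.Ω D.δ).induce D.zdArcA).Preconnected) {p : Site 2 × Fin 4}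
    (he : cTgt p ∈ (discreteDomainGraph D.Ω D.δ).edgeSet) (hB : ∀ x ∈ cTgt p, x ∉ D.zdArcB)
    (hpA : ¬ (p.1 ∈ D.zdArcA ∧ p.1 + cornerUnit (p.2 + 1) ∈ D.zdArcA))
    (hpf : D.IsInnerFace (cFace p)) (hp₂f : D.IsInnerFace (cFace (cornerPartner p))) :
    dartFlux D hD (p.1, p.2 + 1) + dartFlux D hD (p.1 + cornerUnit (p.2 + 1), p.2 + 3) =
      ‖kappa * fkIsingObservable D criticalFKIsingParam (cTgt p)‖ ^ 2 := by
  rw [dartFlux_add_of_snd_eq hD (p.1, p.2 + 1) (p.1 + cornerUnit (p.2 + 1), p.2 + 3) (by simp only; omega),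
    dartObs_out_free hD hA he hB hpA hpf hp₂f]

/-- **Lemma 3.6 at every interior medial vertex: the dart fluxes are closed.** At an edge
`e = cTgt p` of `Ω_δ` with no endpoint on `B`, not an `A`–`A` edge, whose two faces are inner
(admissible data with connected wired arc (H1)), the fluxes of the two darts arriving at `e` and
of the two darts leaving it have the same sum — so that going around `e` through the four squares
`p.1`, `cFace p`, the far endpoint, `cFace (partner p)` the signed increments of `H` cancel
("when one goes around an interior vertex, increments of `H` add up to zero"; Pythagoras on the
projections of `F(e)`). The edges with an endpoint on the wired arc are included.
[cite: Smirnov2010, Lemma 3.6 and its proof] -/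
theorem dartFlux_closed_free [Fintype (meshDomain D.Ω D.δ)] (hD : D.IsZdAdmissible)
    (hA : ((discreteDomainGraph D.Ω D.δ).induce D.zdArcA).Preconnected) {p : Site 2 × Fin 4}
    (he : cTgt p ∈ (discreteDomainGraph D.Ω D.δ).edgeSet) (hB : ∀ x ∈ cTgt p, x ∉ D.zdArcB)
    (hpA : ¬ (p.1 ∈ D.zdArcA ∧ p.1 + cornerUnit (p.2 + 1) ∈ D.zdArcA))
    (hpf : D.IsInnerFace (cFace p)) (hp₂f : D.IsInnerFace (cFace (cornerPartner p))) :
    dartFlux D hD p + dartFlux D hD (cornerPartner p) =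
      dartFlux D hD (p.1, p.2 + 1) + dartFlux D hD (p.1 + cornerUnit (p.2 + 1), p.2 + 3) := by
  rw [dartFlux_in_eq hD hA he hB hpA hpf hp₂f, dartFlux_out_eq hD hA he hB hpA hpf hp₂f]

/-! ### Forced edges: the RBVP at boundary vertices (Lemma 4.11) -/

/-- Passages through a dart and through its successor correspond: if `q⁺ = nextCorner β q` has an
inner face and `q` has an inner face, the times `< N` at which the exploration is at `q⁺` are the
successors of the times at which it is at `q`. [cite: Smirnov2010, proof of Lemma 4.11] -/
theorem filter_cornerOrbit_eq_nextCorner (hD : D.IsZdAdmissible) (ω₀ : Percolation.BondConfig (Site 2))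
    {q : Site 2 × Fin 4} (hqf : D.IsInnerFace (cFace q))
    (hq'f : D.IsInnerFace (cFace (nextCorner (D.bcBondConfig ω₀) q))) :
    (Finset.range (DiscreteDobrushin.exitTime hD ω₀)).filter
        (fun k => cornerOrbit (D.bcBondConfig ω₀) (DiscreteDobrushin.startCorner hD) k = nextCorner (D.bcBondConfig ω₀) q) =
      ((Finset.range (DiscreteDobrushin.exitTime hD ω₀)).filter
        (fun j => cornerOrbit (D.bcBondConfig ω₀) (DiscreteDobrushin.startCorner hD) j = q)).image (· + 1) := by
  set c₀ := DiscreteDobrushin.startCorner hD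
  set β₀ := D.bcBondConfig ω₀
  set N := DiscreteDobrushin.exitTime hD ω₀
  have hc₀ : D.IsStartCorner c₀ := DiscreteDobrushin.isStartCorner_startCorner hD
  have hN : ¬ D.IsInnerFace (cFace (cornerOrbit β₀ c₀ N)) := DiscreteDobrushin.not_isInnerFace_exitTime hD _
  ext k
  simp only [Finset.mem_filter, Finset.mem_range, Finset.mem_image]
  constructor
  · rintro ⟨hk, hke⟩
    obtain ⟨j, rfl⟩ : ∃ j, k = j + 1 := by
      rcases k with _ | k
      · exact absurd hke.symm (by rw [cornerOrbit_zero]; exact nextCorner_ne_start hD hc₀ hqf)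
      · exact ⟨k, rfl⟩
    refine ⟨j, ⟨by omega, ?_⟩, rfl⟩
    rw [cornerOrbit_succ] at hke
    exact nextCorner_injective hke
  · rintro ⟨j, ⟨hj, hjq⟩, rfl⟩
    have hke : cornerOrbit β₀ c₀ (j + 1) = nextCorner β₀ q := by rw [cornerOrbit_succ, hjq]
    refine ⟨?_, hke⟩
    rcases Nat.lt_or_ge (j + 1) N with h | h
    · exact h
    · exfalso
      have : j + 1 = N := by omega
      rw [this] at hke
      exact hN (hke ▸ hq'f)

open scoped Classical in
/-- Per configuration: the weighted passages through the successor dart are `quarterPhase (turnSign q)`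
times those through `q`. [cite: Smirnov2010, proof of Lemma 4.11] -/
theorem sum_filter_nextCorner (hD : D.IsZdAdmissible) (ω₀ : Percolation.BondConfig (Site 2))
    {q : Site 2 × Fin 4} (hqf : D.IsInnerFace (cFace q))
    (hq'f : D.IsInnerFace (cFace (nextCorner (D.bcBondConfig ω₀) q))) :
    (∑ k ∈ (Finset.range (DiscreteDobrushin.exitTime hD ω₀)).filter
        (fun k => cornerOrbit (D.bcBondConfig ω₀) (DiscreteDobrushin.startCorner hD) k = nextCorner (D.bcBondConfig ω₀) q),
        quarterPhase (turnCount (D.bcBondConfig ω₀) (DiscreteDobrushin.startCorner hD) k)) =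
      quarterPhase (turnSign (D.bcBondConfig ω₀) q) *
        ∑ j ∈ (Finset.range (DiscreteDobrushin.exitTime hD ω₀)).filter
          (fun j => cornerOrbit (D.bcBondConfig ω₀) (DiscreteDobrushin.startCorner hD) j = q),
          quarterPhase (turnCount (D.bcBondConfig ω₀) (DiscreteDobrushin.startCorner hD) j) := by
  rw [filter_cornerOrbit_eq_nextCorner hD ω₀ hqf hq'f, Finset.sum_image (fun _ _ _ _ h => Nat.succ_injective h),
    Finset.mul_sum]
  refine Finset.sum_congr rfl fun j hj => ?_
  rw [Finset.mem_filter] at hj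
  rw [turnCount_succ, hj.2, add_comm, quarterPhase_add]

open scoped Classical in
/-- **Following a forced-open edge** (the wired arc: an `A`–`A` edge of `Ω_δ` is open in every
completed configuration). If the target edge of the dart `q` (inner face) is open whatever the
configuration, every passage through `q` is followed by a passage through the dart `q⁺` across the
edge in the same face, a right quarter turn later, and conversely; hence
`dartObs q⁺ = e^{iπ/4} · dartObs q`. [cite: Smirnov2010, proof of Lemma 4.11] -/
theorem dartObs_follow_of_forall_mem [Fintype (meshDomain D.Ω D.δ)] (hD : D.IsZdAdmissible) {q : Site 2 × Fin 4}
    (hqf : D.IsInnerFace (cFace q)) (hopen : ∀ ω : Percolation.BondConfig (Site 2), cTgt q ∈ D.bcBondConfig ω) :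
    dartObs D hD (q.1 + cornerUnit (q.2 + 1), q.2 + 3) = quarterPhase (-1) * dartObs D hD q := by
  unfold dartObs
  rw [Finset.mul_sum]
  refine Finset.sum_congr rfl fun ω _ => ?_
  have hnext : nextCorner (D.bcBondConfig (liftConfig D.Ω D.δ ω)) q = (q.1 + cornerUnit (q.2 + 1), q.2 + 3) :=
    nextCorner_of_mem (hopen _)
  have hq'f : D.IsInnerFace (cFace (nextCorner (D.bcBondConfig (liftConfig D.Ω D.δ ω)) q)) := by
    rw [cFace_nextCorner_of_mem (hopen _)]; exact hqf
  rw [← hnext, sum_filter_nextCorner hD _ hqf hq'f, turnSign_of_mem (hopen _)]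
  ring

open scoped Classical in
/-- **Crossing a forced-closed edge** (the free arc: an edge touching `B` is closed in every
completed configuration). If the target edge of the dart `q` (inner face) is closed whatever the
configuration and the next face around the vertex is inner, every passage through `q` is followed
by a passage through the dart `q⁺ = (q.1, q.2 + 1)`, a left quarter turn later, and conversely;
hence `dartObs q⁺ = e^{-iπ/4} · dartObs q`. [cite: Smirnov2010, proof of Lemma 4.11] -/
theorem dartObs_cross_of_forall_not_mem [Fintype (meshDomain D.Ω D.δ)] (hD : D.IsZdAdmissible) {q : Site 2 × Fin 4}
    (hqf : D.IsInnerFace (cFace q)) (hq'f : D.IsInnerFace (faceAt q.1 (q.2 + 1)))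
    (hclosed : ∀ ω : Percolation.BondConfig (Site 2), cTgt q ∉ D.bcBondConfig ω) :
    dartObs D hD (q.1, q.2 + 1) = quarterPhase 1 * dartObs D hD q := by
  unfold dartObs
  rw [Finset.mul_sum]
  refine Finset.sum_congr rfl fun ω _ => ?_
  have hnext : nextCorner (D.bcBondConfig (liftConfig D.Ω D.δ ω)) q = (q.1, q.2 + 1) :=
    nextCorner_of_not_mem (hclosed _)
  have hq'f' : D.IsInnerFace (cFace (nextCorner (D.bcBondConfig (liftConfig D.Ω D.δ ω)) q)) := by
    rw [cFace_nextCorner_of_not_mem (hclosed _)]; exact hq'f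
  rw [← hnext, sum_filter_nextCorner hD _ hqf hq'f', turnSign_of_not_mem (hclosed _)]
  ring

/-- **Equal fluxes across a forced-open edge** (Smirnov's RBVP, Def. 3.4 / Lemma 4.11, on the
wired arc: "an interface passes through `e` if and only if it passes through `e'`, so
`|F(e)| = |F(e')|`"). [cite: Smirnov2010, Lemma 4.11] -/
theorem dartFlux_follow_eq [Fintype (meshDomain D.Ω D.δ)] (hD : D.IsZdAdmissible) {q : Site 2 × Fin 4}
    (hqf : D.IsInnerFace (cFace q)) (hopen : ∀ ω : Percolation.BondConfig (Site 2), cTgt q ∈ D.bcBondConfig ω) :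
    dartFlux D hD (q.1 + cornerUnit (q.2 + 1), q.2 + 3) = dartFlux D hD q := by
  unfold dartFlux
  rw [dartObs_follow_of_forall_mem hD hqf hopen, norm_mul, norm_quarterPhase, one_mul]

/-- **Equal fluxes across a forced-closed edge** (Smirnov's RBVP on the free arc).
[cite: Smirnov2010, Lemma 4.11] -/
theorem dartFlux_cross_eq [Fintype (meshDomain D.Ω D.δ)] (hD : D.IsZdAdmissible) {q : Site 2 × Fin 4}
    (hqf : D.IsInnerFace (cFace q)) (hq'f : D.IsInnerFace (faceAt q.1 (q.2 + 1)))
    (hclosed : ∀ ω : Percolation.BondConfig (Site 2), cTgt q ∉ D.bcBondConfig ω) :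
    dartFlux D hD (q.1, q.2 + 1) = dartFlux D hD q := by
  unfold dartFlux
  rw [dartObs_cross_of_forall_not_mem hD hqf hq'f hclosed, norm_mul, norm_quarterPhase, one_mul]

/-- An `A`–`A` edge of `Ω_δ` is open in every completed configuration. [cite: Smirnov2001, §2] -/
theorem forall_mem_bcBondConfig_of_arcA {e : Sym2 (Site 2)} (he : e ∈ (discreteDomainGraph D.Ω D.δ).edgeSet)
    (hA : ∀ x ∈ e, x ∈ D.zdArcA) (ω : Percolation.BondConfig (Site 2)) : e ∈ D.bcBondConfig ω :=
  DiscreteDobrushin.mem_bcBondConfig_of_arcA he hA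

/-- An edge touching the arc `B` is closed in every completed configuration. [cite: Smirnov2001, §2] -/
theorem forall_not_mem_bcBondConfig_of_arcB (hD : D.IsZdAdmissible) {e : Sym2 (Site 2)} {x : Site 2}
    (hx : x ∈ e) (hxB : x ∈ D.zdArcB) (ω : Percolation.BondConfig (Site 2)) : e ∉ D.bcBondConfig ω :=
  DiscreteDobrushin.not_mem_bcBondConfig_of_mem_zdArcB hD hx hxB

/-! ### The free arc: darts at `B`-sites are never used -/

/-- **The exploration never turns around a site of the free arc.** Every dart of the orbit of a
start corner has its vertex off the discrete arc `B`: the start vertex is on `A` (disjoint from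
`B`), following an open edge lands at an endpoint of an open edge (edges touching `B` are closed),
and crossing keeps the vertex. [cite: Smirnov2010, §2.2 (Dobrushin boundary conditions)] -/
theorem cornerOrbit_fst_not_mem_zdArcB (hD : D.IsZdAdmissible) {c₀ : Site 2 × Fin 4} (hc₀ : D.IsStartCorner c₀)
    (ω₀ : Percolation.BondConfig (Site 2)) (j : ℕ) : (cornerOrbit (D.bcBondConfig ω₀) c₀ j).1 ∉ D.zdArcB := by
  induction j with
  | zero => exact fun h => Set.disjoint_left.1 hD.disjoint hc₀.mem_zdArcA h
  | succ j ih =>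
    rw [cornerOrbit_succ]
    by_cases h : cTgt (cornerOrbit (D.bcBondConfig ω₀) c₀ j) ∈ D.bcBondConfig ω₀
    · rw [nextCorner_of_mem h]
      intro hB
      refine DiscreteDobrushin.not_mem_bcBondConfig_of_mem_zdArcB hD ?_ hB h
      rw [cTgt]; exact Sym2.mem_mk_right _ _
    · rw [nextCorner_of_not_mem h]
      exact ih

open scoped Classical in
/-- **Darts at a `B`-site have zero observable**, hence zero flux: `H(f) = H(b)` for every inner
face `f` at a site `b` of the free arc — the discrete primitive does not jump between the free arc
and the adjacent faces ("`H` is constant on the boundary arc", Lemma 3.10, in the tree's rendering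
of the dual-wired arc). [cite: Smirnov2010, Lemma 3.10 and Lemma 4.11] -/
theorem dartObs_eq_zero_of_mem_zdArcB [Fintype (meshDomain D.Ω D.δ)] (hD : D.IsZdAdmissible) {q : Site 2 × Fin 4}
    (hq : q.1 ∈ D.zdArcB) : dartObs D hD q = 0 := by
  unfold dartObs
  refine Finset.sum_eq_zero fun ω _ => ?_
  rw [Finset.sum_eq_zero, mul_zero]
  intro j hj
  rw [Finset.mem_filter] at hj
  exact absurd hq (hj.2 ▸ cornerOrbit_fst_not_mem_zdArcB hD (DiscreteDobrushin.isStartCorner_startCorner hD) _ j)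

/-- Zero flux at the free arc. [cite: Smirnov2010, Lemma 3.10 and Lemma 4.11] -/
theorem dartFlux_eq_zero_of_mem_zdArcB [Fintype (meshDomain D.Ω D.δ)] (hD : D.IsZdAdmissible) {q : Site 2 × Fin 4}
    (hq : q.1 ∈ D.zdArcB) : dartFlux D hD q = 0 := by
  rw [dartFlux, dartObs_eq_zero_of_mem_zdArcB hD hq, norm_zero, zero_pow two_ne_zero]

/-! ### The jump at the start edge `e_a` -/

open scoped Classical in
/-- **The start dart is passed exactly once, first, with weight one**: `dartObs c₀ = 1`
("every interface passes through `b`, and furthermore has the same complex weight at `b`", proof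
of Lemma 4.11, at the tree's winding origin `e_a`). [cite: Smirnov2010, proof of Lemma 4.11] -/
theorem dartObs_startCorner [Fintype (meshDomain D.Ω D.δ)] (hD : D.IsZdAdmissible) :
    dartObs D hD (DiscreteDobrushin.startCorner hD) = 1 := by
  have hc₀ : D.IsStartCorner (DiscreteDobrushin.startCorner hD) := DiscreteDobrushin.isStartCorner_startCorner hD
  have hinner : ∀ ω₀ : Percolation.BondConfig (Site 2),
      (∑ j ∈ (Finset.range (DiscreteDobrushin.exitTime hD ω₀)).filter
          (fun j => cornerOrbit (D.bcBondConfig ω₀) (DiscreteDobrushin.startCorner hD) j = DiscreteDobrushin.startCorner hD),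
        quarterPhase (turnCount (D.bcBondConfig ω₀) (DiscreteDobrushin.startCorner hD) j)) = 1 := by
    intro ω₀
    have hfilt : (Finset.range (DiscreteDobrushin.exitTime hD ω₀)).filter
        (fun j => cornerOrbit (D.bcBondConfig ω₀) (DiscreteDobrushin.startCorner hD) j = DiscreteDobrushin.startCorner hD) =
        {0} := by
      ext j
      simp only [Finset.mem_filter, Finset.mem_range, Finset.mem_singleton]
      constructor
      · rintro ⟨hj, h⟩
        by_contra hne
        have hlt : 0 < j := Nat.pos_of_ne_zero hne
        exact cornerOrbit_ne hD hc₀ hlt (fun k hk => DiscreteDobrushin.isInnerFace_of_lt_exitTime hD ω₀ (by omega))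
          (by rw [cornerOrbit_zero]; exact h.symm)
      · rintro rfl
        exact ⟨DiscreteDobrushin.exitTime_pos hD ω₀, cornerOrbit_zero⟩
    rw [hfilt, Finset.sum_singleton, turnCount_zero, quarterPhase]
    simp
  unfold dartObs
  rw [Finset.sum_congr rfl fun ω _ => by rw [hinner, mul_one]]
  have hZ := rcPartitionFunction_pos D.interfaceGraph criticalFKIsingParam_mem_Icc two_pos (Subtype.val ⁻¹' D.zdArcA)
  rw [← Complex.ofReal_sum, ← Finset.sum_div, ← rcPartitionFunction, div_self hZ.ne', Complex.ofReal_one]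

/-- **Unit flux at the start edge**: the discrete primitive jumps by exactly `1` across the start
dart (from the `A`-end `a` of `e_a` to the inner face of `e_a`) — the tree's form of "`H = 0` on
`(ab)`, `H = 1` on `(ba)`" (Lemma 4.11), the jump sitting at the winding origin.
[cite: Smirnov2010, Lemma 4.11] -/
theorem dartFlux_startCorner [Fintype (meshDomain D.Ω D.δ)] (hD : D.IsZdAdmissible) :
    dartFlux D hD (DiscreteDobrushin.startCorner hD) = 1 := by
  rw [dartFlux, dartObs_startCorner hD, norm_one, one_pow]

end Flux

end Literature.Probability.LatticeModels
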